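import Literature.Geometry.Symplectic.CircleInvariantForms
import HarnessLib

/-!
# The curvature of a connection form is basic (`ι_X dα = 0`, `(a • ·)^* dα = dα`)

Seventh proofs companion of `OrigamiUnfolding.lean` (fact seat of
`Literature.Geometry.Symplectic.exists_symplecticCutPieces_of_isOrigamiForm`), step (S1)/(S2) of
the unfolding (Cannas da Silva–Guillemin–Pires, *Symplectic Origami*, proof of Prop. 2.8; Cannas
da Silva–Guillemin–Woodward 2000, Thm. 1): for the Moser model `p^*i^*ω + d(t² p^*α)` and for
the reduced forms on the cuts one needs that the differential `dα` of the connection form `α`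
of the null fibration is BASIC — horizontal, `ι_X dα = 0`, and invariant — so that it is the
pull-back of the curvature `2`-form on the base (`CircleQuotientForms.circleDescend`).
Classically `ι_X dα = ℒ_X α - d(α(X)) = 0` by Cartan's formula; here, as in
`CircleInvariantForms.lean`, it is proved WITHOUT Cartan's formula through the flat
trivialisation `(u, t) ↦ exp t • param u` of a slice: the pull-back `β` of an invariant `α` with
`α(X) ≡ 1` has `t`-independent coefficients and `β(∂_t) ≡ 1`, whence
`dβ(∂_t, w) = ∂_t β(w) - ∂_w β(∂_t) = 0` (Mathlib's `extDeriv_apply`).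

* `pullback_sliceTrivR_apply_inr_eq_one`, `pullback_sliceTrivR_translate`,
  `fderiv_pullback_sliceTrivR_inr_of_invariant`, `extDeriv_pullback_sliceTrivR_apply_inr` —
  the flat computation;
* `mextDeriv_apply_circleFundVec_eq_zero` — **`ι_X dα = 0`** at every point of `N`;
* `mextDeriv_apply_smul_of_invariant` — **`dα` is invariant** when `α` is (naturality of `d`,
  `mextDeriv_pullback_apply`), for forms of any degree;
* `isCircleBasicForm_mextDeriv` — hence `dα` is `IsCircleBasicForm`.

Everything here is proved; no definitions, no facts.

## References

* A. Cannas da Silva, V. Guillemin, C. Woodward, *On the unfolding of folded symplectic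
  structures*, Math. Res. Lett. 7 (2000), proof of Thm. 1. [CannasGuilleminWoodward2000]
* S. Kobayashi, K. Nomizu, *Foundations of Differential Geometry I* (1963), Ch. II, §5
  (curvature form; the structure equation for abelian groups: `dα = π^*F`).
-/

noncomputable section

open scoped Manifold ContDiff Topology
open Set Function Module Filter
open Literature.Geometry.Kaehler Literature.Geometry.Manifold

namespace Literature.Geometry.Symplectic

section Flat

variable {m : ℕ} {N : Type*} [TopologicalSpace N] [ChartedSpace (EuclideanSpace ℝ (Fin m)) N]
  [MulAction Circle N] {F : Type*} [NormedAddCommGroup F] [NormedSpace ℝ F]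
  {p : N} (d : CircleSliceData (EuclideanSpace ℝ (Fin m)) F p)

/-- `Fin.removeNth` on pairs. [folklore] -/
private theorem removeNth_zero_two {X : Type*} (a b : X) :
    (0 : Fin 2).removeNth ![a, b] = ![b] := by
  funext i; fin_cases i; rfl

/-- `Fin.removeNth` on pairs. [folklore] -/
private theorem removeNth_one_two {X : Type*} (a b : X) :
    (1 : Fin 2).removeNth ![a, b] = ![a] := by
  funext i; fin_cases i; rfl

/-- **`β(∂_t) ≡ 1`**: the pull-back to the flat trivialisation of a `1`-form normalised on the
fundamental vector field takes the value `1` on `∂_t`. [folklore] -/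
theorem pullback_sliceTrivR_apply_inr_eq_one {α : MForm (𝓡 m) N ℝ 1}
    (hθ : ContMDiff ((𝓡 1).prod (𝓡 m)) (𝓡 m) ∞ (fun x : Circle × N => x.1 • x.2))
    (hX : ∀ n : N, α n ![circleFundVec n] = 1) {x : F × ℝ} (hx : x ∈ sliceDomR d) :
    (α.pullback 𝓘(ℝ, F × ℝ) (sliceTrivR d)) x ![((0, 1) : F × ℝ)] = 1 := by
  rw [MForm.pullback_apply]
  have hvec : (fun i : Fin 1 => mfderiv 𝓘(ℝ, F × ℝ) (𝓡 m) (sliceTrivR d) x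
      ((![((0, 1) : F × ℝ)] : Fin 1 → F × ℝ) i)) = ![circleFundVec (sliceTrivR d x)] := by
    funext i
    fin_cases i
    exact mfderiv_sliceTrivR_inr d hθ hx
  exact (congrArg (α (sliceTrivR d x)) hvec).trans (hX _)

/-- **Equivariance of the differential of the trivialisation**:
`d(exp s • ·) ∘ dT_x = dT_{x + (0, s)}`. [folklore] -/
theorem mfderiv_smul_mfderiv_sliceTrivR
    (hθ : ContMDiff ((𝓡 1).prod (𝓡 m)) (𝓡 m) ∞ (fun x : Circle × N => x.1 • x.2))
    {x : F × ℝ} (hx : x ∈ sliceDomR d) (s : ℝ) (w : F × ℝ) :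
    mfderiv (𝓡 m) (𝓡 m) (fun y : N => Circle.exp s • y) (sliceTrivR d x)
        (mfderiv 𝓘(ℝ, F × ℝ) (𝓡 m) (sliceTrivR d) x w) =
      mfderiv 𝓘(ℝ, F × ℝ) (𝓡 m) (sliceTrivR d) (x + ((0 : F), s)) w := by
  have hTd : ∀ y ∈ sliceDomR d, MDifferentiableAt 𝓘(ℝ, F × ℝ) (𝓡 m) (sliceTrivR d) y :=
    fun y hy => ((contMDiffOn_sliceTrivR d hθ).contMDiffAt
      ((isOpen_sliceDomR d).mem_nhds hy)).mdifferentiableAt (by simp)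
  have hsm' : ContMDiff (𝓡 m) (𝓡 m) ∞ (fun y : N => Circle.exp s • y) :=
    hθ.comp (contMDiff_const.prodMk contMDiff_id)
  have hA := (hsm'.mdifferentiableAt (x := sliceTrivR d x) (by simp)).hasMFDerivAt.comp x
    (hTd x hx).hasMFDerivAt
  have hx₁D : x + ((0 : F), s) ∈ sliceDomR d := by
    show (x + ((0 : F), s)).1 ∈ d.dom
    simpa using (show x.1 ∈ d.dom from hx)
  have hτ : HasMFDerivAt 𝓘(ℝ, F × ℝ) 𝓘(ℝ, F × ℝ) (fun y : F × ℝ => y + ((0 : F), s)) x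
      (ContinuousLinearMap.id ℝ (F × ℝ)) :=
    hasMFDerivAt_iff_hasFDerivAt.2 ((hasFDerivAt_id x).add_const _)
  have hB := HasMFDerivAt.comp (f := fun y : F × ℝ => y + ((0 : F), s)) x
    (hTd _ hx₁D).hasMFDerivAt hτ
  have hfun : ((fun y : N => Circle.exp s • y) ∘ sliceTrivR d) =
      (sliceTrivR d ∘ fun y : F × ℝ => y + ((0 : F), s)) := by
    funext y
    exact smul_sliceTrivR d s y
  rw [hfun] at hA
  exact congrArg (fun L => L w) (hA.mfderiv.symm.trans hB.mfderiv)

/-- **Translation invariance of the pull-back of an invariant `1`-form**: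
`β(x + (0, s)) = β(x)` (equivariance `exp s • T x = T (x + (0, s))`). [folklore] -/
theorem pullback_sliceTrivR_translate {α : MForm (𝓡 m) N ℝ 1}
    (hθ : ContMDiff ((𝓡 1).prod (𝓡 m)) (𝓡 m) ∞ (fun x : Circle × N => x.1 • x.2))
    (hinv : ∀ (a : Circle) (n : N) (v : Fin 1 → TangentSpace (𝓡 m) n),
      α (a • n) (fun i => mfderiv (𝓡 m) (𝓡 m) (fun y : N => a • y) n (v i)) = α n v)
    {x : F × ℝ} (hx : x ∈ sliceDomR d) (s : ℝ) (w : Fin 1 → F × ℝ) :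
    (α.pullback 𝓘(ℝ, F × ℝ) (sliceTrivR d)) (x + ((0 : F), s)) w =
      (α.pullback 𝓘(ℝ, F × ℝ) (sliceTrivR d)) x w := by
  rw [MForm.pullback_apply, MForm.pullback_apply]
  have transport : ∀ {q q' : N} (_ : q = q') (u : Fin 1 → EuclideanSpace ℝ (Fin m)),
      α q u = α q' u := by
    intro q q' h u; subst h; rfl
  have hpt : sliceTrivR d (x + ((0 : F), s)) = Circle.exp s • sliceTrivR d x :=
    (smul_sliceTrivR d s x).symm
  rw [transport hpt]
  have hvec : (fun i => (mfderiv 𝓘(ℝ, F × ℝ) (𝓡 m) (sliceTrivR d) (x + ((0 : F), s)) (w i) :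
      EuclideanSpace ℝ (Fin m))) = fun i => mfderiv (𝓡 m) (𝓡 m) (fun y : N => Circle.exp s • y)
        (sliceTrivR d x) (mfderiv 𝓘(ℝ, F × ℝ) (𝓡 m) (sliceTrivR d) x (w i)) := by
    funext i
    exact (mfderiv_smul_mfderiv_sliceTrivR d hθ hx s (w i)).symm
  rw [hvec]
  exact hinv (Circle.exp s) (sliceTrivR d x) _

variable [IsManifold (𝓡 m) ∞ N]

/-- **`∂_t` of the coefficients of the pull-back of an invariant `1`-form vanishes.**
[folklore] -/
theorem fderiv_pullback_sliceTrivR_inr_of_invariant {α : MForm (𝓡 m) N ℝ 1}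
    (hθ : ContMDiff ((𝓡 1).prod (𝓡 m)) (𝓡 m) ∞ (fun x : Circle × N => x.1 • x.2))
    (hsm : IsSmoothForm α)
    (hinv : ∀ (a : Circle) (n : N) (v : Fin 1 → TangentSpace (𝓡 m) n),
      α (a • n) (fun i => mfderiv (𝓡 m) (𝓡 m) (fun y : N => a • y) n (v i)) = α n v)
    {x : F × ℝ} (hx : x ∈ sliceDomR d) (w : F × ℝ) :
    fderiv ℝ (fun y => (show (F × ℝ) → (F × ℝ) [⋀^Fin 1]→L[ℝ] ℝ from
      α.pullback 𝓘(ℝ, F × ℝ) (sliceTrivR d)) y ![w]) x ((0, 1) : F × ℝ) = 0 := by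
  set β := (show (F × ℝ) → (F × ℝ) [⋀^Fin 1]→L[ℝ] ℝ from
    α.pullback 𝓘(ℝ, F × ℝ) (sliceTrivR d)) with hβ
  have h0 : x + ((0 : F), (0 : ℝ)) = x := by simp
  have hdiff : DifferentiableAt ℝ (fun y : F × ℝ => β y ![w]) (x + ((0 : F), (0 : ℝ))) := by
    rw [h0]
    have hd : DifferentiableAt ℝ β x :=
      (contDiffAt_of_smoothAt_self (smoothAt_pullback_sliceTrivR d hθ hsm hx)).differentiableAt
        (by simp)
    exact hd.continuousAlternatingMap_apply_const ![w]
  have hline : HasFDerivAt (fun s : ℝ => x + ((0 : F), s)) (ContinuousLinearMap.inr ℝ F ℝ) 0 :=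
    ((ContinuousLinearMap.inr ℝ F ℝ).hasFDerivAt).const_add x
  have hc : HasDerivAt (fun s : ℝ => β (x + ((0 : F), s)) ![w])
      (fderiv ℝ (fun y : F × ℝ => β y ![w]) (x + ((0 : F), (0 : ℝ))) ((0, 1) : F × ℝ)) 0 :=
    (HasFDerivAt.comp (0 : ℝ) (g := fun y : F × ℝ => β y ![w]) (f := fun s : ℝ => x + ((0 : F), s))
      hdiff.hasFDerivAt hline).hasDerivAt
  rw [h0] at hc
  have hconst : (fun s : ℝ => β (x + ((0 : F), s)) ![w]) = fun _ => β x ![w] :=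
    funext fun s => pullback_sliceTrivR_translate d hθ hinv hx s ![w]
  rw [hconst] at hc
  exact hc.unique (hasDerivAt_const 0 _) |>.symm ▸ rfl

/-- **`dβ(∂_t, w) = 0`** for the pull-back `β` of a smooth invariant `1`-form with `α(X) ≡ 1`:
`dβ(∂_t, w) = ∂_t β(w) - ∂_w β(∂_t)` and both terms vanish. [folklore] -/
theorem extDeriv_pullback_sliceTrivR_apply_inr {α : MForm (𝓡 m) N ℝ 1}
    (hθ : ContMDiff ((𝓡 1).prod (𝓡 m)) (𝓡 m) ∞ (fun x : Circle × N => x.1 • x.2))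
    (hsm : IsSmoothForm α)
    (hinv : ∀ (a : Circle) (n : N) (v : Fin 1 → TangentSpace (𝓡 m) n),
      α (a • n) (fun i => mfderiv (𝓡 m) (𝓡 m) (fun y : N => a • y) n (v i)) = α n v)
    (hX : ∀ n : N, α n ![circleFundVec n] = 1) {x : F × ℝ} (hx : x ∈ sliceDomR d) (w : F × ℝ) :
    extDeriv (show (F × ℝ) → (F × ℝ) [⋀^Fin 1]→L[ℝ] ℝ from
      α.pullback 𝓘(ℝ, F × ℝ) (sliceTrivR d)) x ![((0, 1) : F × ℝ), w] = 0 := by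
  set β := (show (F × ℝ) → (F × ℝ) [⋀^Fin 1]→L[ℝ] ℝ from
    α.pullback 𝓘(ℝ, F × ℝ) (sliceTrivR d)) with hβ
  have hdiff : DifferentiableAt ℝ β x :=
    (contDiffAt_of_smoothAt_self (smoothAt_pullback_sliceTrivR d hθ hsm hx)).differentiableAt
      (by simp)
  rw [extDeriv_apply hdiff, Fin.sum_univ_two]
  simp only [Fin.val_zero, pow_zero, one_smul, Fin.val_one, pow_one, neg_smul,
    Matrix.cons_val_zero, Matrix.cons_val_one]
  rw [removeNth_zero_two, removeNth_one_two]
  -- `∂_t β(w) = 0`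
  have h1 : fderiv ℝ (fun y => β y ![w]) x ((0, 1) : F × ℝ) = 0 :=
    fderiv_pullback_sliceTrivR_inr_of_invariant d hθ hsm hinv hx w
  -- `β(∂_t) ≡ 1` near `x`, so `∂_w β(∂_t) = 0`
  have h2 : fderiv ℝ (fun y => β y ![((0, 1) : F × ℝ)]) x w = 0 := by
    have hev : (fun y => β y ![((0, 1) : F × ℝ)]) =ᶠ[𝓝 x] fun _ => (1 : ℝ) := by
      filter_upwards [(isOpen_sliceDomR d).mem_nhds hx] with y hy
      exact pullback_sliceTrivR_apply_inr_eq_one d hθ hX hy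
    rw [hev.fderiv_eq, fderiv_const_apply]
    rfl
  rw [h1, h2]
  simp

/-- **`dα(X, dT w) = 0` over a slice**: the pull-back of `dα` along the trivialisation `T` is
`dβ` (naturality of `d`), which kills `∂_t`. [folklore] -/
theorem mextDeriv_apply_circleFundVec_sliceTrivR {α : MForm (𝓡 m) N ℝ 1}
    (hθ : ContMDiff ((𝓡 1).prod (𝓡 m)) (𝓡 m) ∞ (fun x : Circle × N => x.1 • x.2))
    (hsm : IsSmoothForm α)
    (hinv : ∀ (a : Circle) (n : N) (v : Fin 1 → TangentSpace (𝓡 m) n),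
      α (a • n) (fun i => mfderiv (𝓡 m) (𝓡 m) (fun y : N => a • y) n (v i)) = α n v)
    (hX : ∀ n : N, α n ![circleFundVec n] = 1) {x : F × ℝ} (hx : x ∈ sliceDomR d) (w : F × ℝ) :
    mextDeriv α (sliceTrivR d x)
      ![circleFundVec (sliceTrivR d x), mfderiv 𝓘(ℝ, F × ℝ) (𝓡 m) (sliceTrivR d) x w] = 0 := by
  have hf : ∀ᶠ y in 𝓝 x, ContMDiffAt 𝓘(ℝ, F × ℝ) (𝓡 m) ∞ (sliceTrivR d) y := by
    filter_upwards [(isOpen_sliceDomR d).mem_nhds hx] with y hy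
    exact (contMDiffOn_sliceTrivR d hθ).contMDiffAt ((isOpen_sliceDomR d).mem_nhds hy)
  have hnat := mextDeriv_pullback_apply hf ((isSmoothForm_iff_smoothAt α).1 hsm _)
  have h1 : mextDeriv (α.pullback 𝓘(ℝ, F × ℝ) (sliceTrivR d)) x ![((0, 1) : F × ℝ), w] = 0 := by
    rw [mextDeriv_eq_extDeriv]
    exact extDeriv_pullback_sliceTrivR_apply_inr d hθ hsm hinv hX hx w
  rw [hnat, MForm.pullback_apply] at h1
  have hvec : (fun i : Fin 2 => mfderiv 𝓘(ℝ, F × ℝ) (𝓡 m) (sliceTrivR d) x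
      ((![((0, 1) : F × ℝ), w] : Fin 2 → F × ℝ) i)) =
      ![circleFundVec (sliceTrivR d x), mfderiv 𝓘(ℝ, F × ℝ) (𝓡 m) (sliceTrivR d) x w] := by
    funext i
    fin_cases i
    · exact mfderiv_sliceTrivR_inr d hθ hx
    · rfl
  exact (congrArg (mextDeriv α (sliceTrivR d x)) hvec).symm.trans h1

end Flat

/-! ### Conclusion on `N` -/

section Global

variable {m : ℕ} {N : Type*} [TopologicalSpace N] [ChartedSpace (EuclideanSpace ℝ (Fin m)) N]
  [MulAction Circle N] {F : Type*} [NormedAddCommGroup F] [NormedSpace ℝ F]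
  [IsManifold (𝓡 m) ∞ N] [T2Space N] [FiniteDimensional ℝ F]

/-- **`ι_X dα = 0` for an invariant `1`-form with `α(X) ≡ 1`** (the curvature of a connection
form is horizontal), at every point of `N`: every point lies over a slice, where this is
`mextDeriv_apply_circleFundVec_sliceTrivR` (the differential of the trivialisation is onto, by
the smooth local section `sliceSecR`).  The auxiliary space `F` has dimension `m - 1` (the
model of the orbit space). [cite: CannasGuilleminWoodward2000, proof of Thm. 1] -/
theorem mextDeriv_apply_circleFundVec_eq_zero {α : MForm (𝓡 m) N ℝ 1}
    (hθ : ContMDiff ((𝓡 1).prod (𝓡 m)) (𝓡 m) ∞ (fun x : Circle × N => x.1 • x.2))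
    (hfree : ∀ (a : Circle) (x : N), a • x = x → a = 1)
    (hF : Module.finrank ℝ F + 1 = m)
    (hsm : IsSmoothForm α)
    (hinv : ∀ (a : Circle) (n : N) (v : Fin 1 → TangentSpace (𝓡 m) n),
      α (a • n) (fun i => mfderiv (𝓡 m) (𝓡 m) (fun y : N => a • y) n (v i)) = α n v)
    (hX : ∀ n : N, α n ![circleFundVec n] = 1) (n : N) (w : TangentSpace (𝓡 m) n) :
    mextDeriv α n ![circleFundVec n, w] = 0 := by
  haveI : ContinuousSMul Circle N := ⟨hθ.continuous⟩
  letI := circleQuotientChartedSpace F hθ hfree hF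
  -- the slice at the chosen representative of the orbit of `n`
  set p : N := (circleQuotientMk n : CircleQuotient N).out with hp
  set d : CircleSliceData (EuclideanSpace ℝ (Fin m)) F p := circleSliceDataAt hθ hfree hF p
    with hd
  have hn : n ∈ circleQuotientMk ⁻¹' d.chart.source := by
    rw [mem_preimage, d.chart_source]
    have hpn : circleQuotientMk p = circleQuotientMk n := Quotient.out_eq _
    rw [← hpn]
    exact ⟨p, d.hpT, rfl⟩
  obtain ⟨a₀, ha₀⟩ := d.exists_inv_smul_mem_T hn
  obtain ⟨t, rfl⟩ := Circle.exp_surjective a₀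
  -- `n = sliceTrivR d x₀`, `x₀ = sliceSecR d t n`
  set x₀ : F × ℝ := sliceSecR d t n with hx₀
  have huD : x₀.1 ∈ d.dom := d.coord_mem_dom ha₀
  have hx₀D : x₀ ∈ sliceDomR d := huD
  have hn₀ : sliceTrivR d x₀ = n := sliceTrivR_sliceSecR d t ha₀
  -- the differential of `T` at `x₀` is onto: `dT ∘ dσ = id`
  have hO : {y : N | (Circle.exp t)⁻¹ • y ∈ d.T} ∈ 𝓝 n :=
    (d.hTo.preimage (continuous_const_smul _)).mem_nhds ha₀
  have hTd : MDifferentiableAt 𝓘(ℝ, F × ℝ) (𝓡 m) (sliceTrivR d) x₀ :=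
    ((contMDiffOn_sliceTrivR d hθ).contMDiffAt
      ((isOpen_sliceDomR d).mem_nhds hx₀D)).mdifferentiableAt (by simp)
  have hσd : MDifferentiableAt (𝓡 m) 𝓘(ℝ, F × ℝ) (sliceSecR d t) n :=
    ((contMDiffOn_sliceSecR d hθ t).contMDiffAt hO).mdifferentiableAt (by simp)
  have hc := hTd.hasMFDerivAt.comp n hσd.hasMFDerivAt
  have hloc : (sliceTrivR d ∘ sliceSecR d t) =ᶠ[𝓝 n] id := by
    filter_upwards [hO] with y hy
    exact sliceTrivR_sliceSecR d t hy
  have hc' := hc.congr_of_eventuallyEq hloc.symm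
  have heq := hc'.mfderiv.symm.trans (hasMFDerivAt_id (I := 𝓡 m) n).mfderiv
  have hid : mfderiv 𝓘(ℝ, F × ℝ) (𝓡 m) (sliceTrivR d) x₀
      (mfderiv (𝓡 m) 𝓘(ℝ, F × ℝ) (sliceSecR d t) n w) = w := congrArg (fun L => L w) heq
  -- the flat statement at `x₀`, transported to `n`
  have key := mextDeriv_apply_circleFundVec_sliceTrivR d hθ hsm hinv hX hx₀D
    (mfderiv (𝓡 m) 𝓘(ℝ, F × ℝ) (sliceSecR d t) n w)
  have transfer : ∀ {q q' : N} (_ : q = q') (u : EuclideanSpace ℝ (Fin m)),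
      mextDeriv α q ![circleFundVec q, u] = 0 → mextDeriv α q' ![circleFundVec q', u] = 0 := by
    intro q q' h u hq; subst h; exact hq
  have key' := transfer hn₀ _ key
  rw [hid] at key'
  exact key'

omit [T2Space N] [FiniteDimensional ℝ F] in
/-- **`d` of an invariant form is invariant** (naturality of `d` along the diffeomorphisms
`a • ·`, `mextDeriv_pullback_apply`), for smooth forms of any degree. [folklore] -/
theorem mextDeriv_apply_smul_of_invariant {k : ℕ} {α : MForm (𝓡 m) N ℝ k}
    (hθ : ContMDiff ((𝓡 1).prod (𝓡 m)) (𝓡 m) ∞ (fun x : Circle × N => x.1 • x.2))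
    (hsm : IsSmoothForm α)
    (hinv : ∀ (a : Circle) (n : N) (v : Fin k → TangentSpace (𝓡 m) n),
      α (a • n) (fun i => mfderiv (𝓡 m) (𝓡 m) (fun y : N => a • y) n (v i)) = α n v)
    (a : Circle) (n : N) (v : Fin (k + 1) → TangentSpace (𝓡 m) n) :
    mextDeriv α (a • n) (fun i => mfderiv (𝓡 m) (𝓡 m) (fun y : N => a • y) n (v i)) =
      mextDeriv α n v := by
  have hf : ContMDiff (𝓡 m) (𝓡 m) ∞ (fun y : N => a • y) :=
    hθ.comp (contMDiff_const.prodMk contMDiff_id)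
  have hpb : α.pullback (𝓡 m) (fun y : N => a • y) = α := by
    funext y
    ext u
    rw [MForm.pullback_apply]
    exact hinv a y u
  have h := mextDeriv_pullback_apply (I := 𝓡 m) (I' := 𝓡 m) (f := fun y : N => a • y) (β := α)
    (x := n) (Eventually.of_forall fun z => hf.contMDiffAt) ((isSmoothForm_iff_smoothAt α).1 hsm _)
  rw [hpb] at h
  have happ : mextDeriv α n v = ((mextDeriv α).pullback (𝓡 m) (fun y : N => a • y)) n v :=
    congrArg (fun γ => γ v) h
  rw [MForm.pullback_apply] at happ
  exact happ.symm

/-- **The curvature of a connection form is basic**: for a free smooth circle action on a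
Hausdorff manifold `N` modelled on `ℝᵐ` and a smooth invariant `1`-form `α` with `α(X) ≡ 1`,
the `2`-form `dα` is invariant and horizontal (`IsCircleBasicForm`), hence descends to the orbit
manifold (`IsCircleBasicForm.pullback_circleDescend`: `dα = π^* F`, the structure equation of an
`S¹`-connection). [cite: CannasGuilleminWoodward2000, proof of Thm. 1] -/
theorem isCircleBasicForm_mextDeriv {α : MForm (𝓡 m) N ℝ 1}
    (hθ : ContMDiff ((𝓡 1).prod (𝓡 m)) (𝓡 m) ∞ (fun x : Circle × N => x.1 • x.2))
    (hfree : ∀ (a : Circle) (x : N), a • x = x → a = 1)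
    (hF : Module.finrank ℝ F + 1 = m)
    (hsm : IsSmoothForm α)
    (hinv : ∀ (a : Circle) (n : N) (v : Fin 1 → TangentSpace (𝓡 m) n),
      α (a • n) (fun i => mfderiv (𝓡 m) (𝓡 m) (fun y : N => a • y) n (v i)) = α n v)
    (hX : ∀ n : N, α n ![circleFundVec n] = 1) :
    IsCircleBasicForm (mextDeriv α) := by
  refine ⟨mextDeriv_apply_smul_of_invariant hθ hsm hinv, fun n v i hi => ?_⟩
  have hv : v = ![v 0, v 1] := by
    funext j; fin_cases j <;> rfl
  fin_cases i
  · rw [hv]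
    have h0 : v 0 = circleFundVec n := hi
    rw [h0]
    exact mextDeriv_apply_circleFundVec_eq_zero (F := F) hθ hfree hF hsm hinv hX n (v 1)
  · rw [hv]
    have h1 : v 1 = circleFundVec n := hi
    rw [h1]
    have hsw := (mextDeriv α n).map_swap ![v 0, circleFundVec n] (i := 0) (j := 1) (by decide)
    have hvec : (![v 0, circleFundVec n] : Fin 2 → TangentSpace (𝓡 m) n) ∘ Equiv.swap (0 : Fin 2) 1 =
        ![circleFundVec n, v 0] := by
      funext j; fin_cases j <;> rfl
    rw [hvec] at hsw
    have h0 : mextDeriv α n ![circleFundVec n, v 0] = 0 :=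
      mextDeriv_apply_circleFundVec_eq_zero (F := F) hθ hfree hF hsm hinv hX n (v 0)
    have hsw' : mextDeriv α n ![circleFundVec n, v 0] = -mextDeriv α n ![v 0, circleFundVec n] :=
      hsw
    rw [h0] at hsw'
    exact neg_eq_zero.1 hsw'.symm

end Global

end Literature.Geometry.Symplectic

end
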